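import Mathlib
import HarnessLib
import HarnessLib.Audit
import Summits.QuantumAdvantage.Statement
import Literature.Computability.QuantumComplexity.BQP
import HarnessLib.Audit.Status.Attr
-- import Summits.QuantumAdvantage.QuantumAdvantage.Theorems.ShorLocallyDarkAssembly dropped: it (transitively) imports this route file — proofs used by `closes`/`_holds` must live in a module that does not import the Theses file

/-!
Route: ShorLocallyDark

DORMANT since 2026-08-26T14:17:34Z (reconciler: no traction for 6.7 d (last activity item-proof-filed at 2026-08-19T20:57:09Z); parked, not closed — `ledger route dormant route-QuantumAdvantage-ShorLocallyDark --off` to reactivate) — unstaffed, not closed; items shared with open routes are served there. `ledger route dormant <id> --off` reactivates.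

# Route ShorLocallyDark — Shor's register is locally dark — AN-code distance of the period (linear
order) and subgroup digit sums blind correlation-order closures

Route ShorLocallyDark realises idea card QuantumAdvantage/QuantumAdvantage/shor-is-locally-dark
(NEGATIVE side, Dequantize- /PauliFlat-shaped).
THESIS X (= item ClosureThesis, the same decl as Dequantize's and PauliFlat's target): every
language decided with error 1/3 by a
poly-time uniform oracle-free Clifford+T family is in BPP. IT SUFFICES: `X → ¬QuantumAdvantage`
(item Assembly,
pure logic, one line; rev-3 repair 2026-08-15 removed the vacuous named-fact hypothesis
BPP_subset_BQP from the item, as in Dequantize rev 4). ROAD TO X (expected FALSE; the route exists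
for its KILLS): the correlation-order
CLOSURE hypothesis H_CL — the acceptance statistics of every uniform family can be tracked by
propagating the family of ≤k-body
reduced density matrices / cumulants with k = O(log n) or cost n^{O(k)} = poly (BBGKY/cumulant
truncation, cluster mean field,
belief propagation with loop corrections of size ≤ k — the method that dequantized IBM's 127-qubit
utility experiment,
TindallEtAl2024 = arXiv:2306.14887; arXiv:2409.03108; arXiv:2308.05077 — and level-k marginal SDPs).
DELIVERABLES = theorems saying
that on the canonical witness, Shor's order-finding register |ψ_{a,N}⟩ = 2^{-n}Σ_{x<4^n}|x⟩|a^x mod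
N⟩ (2n control qubits, n work
qubits, N = pq an n-bit RSA modulus), every ≤k-body marginal is (exactly or up to N^{-c})
INDEPENDENT of a and of the period
r = ord_N(a): (i) EXACTLY on the control register up to order k < d(r) := the minimum distance of
the binary AN code generated by r on
2n positions (least weight of a nonzero {-1,0,1}-combination of 2^0..2^{2n-1} divisible by r; item
ControlMarginalFormula), with
d(ord_N(a)) ≥ c·n for all but 2^{-cn} of the pairs (N,a) (item OrderSparseMultiplesRare — LINEAR
order, correcting the card's
n/log n); (ii) up to N^{-c} on every mixed control/work marginal of order (|S|+|T|)·log n ≤ c·n for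
typical BALANCED pairs (N = pq with p, q ≥ N^{1/3}; a) (item
MixedMarginalsDarkR — REPAIR 2026-08-15: its unbalanced predecessor MixedMarginalsDark is REFUTED as
typed, N = 2q makes bit 0 of
a^x mod N constant (Theorems/ShorLocallyDarkMixedMarginalsDarkRefutation.lean), and stays in the
file as a settled negative edge), through digit equidistribution of the subgroup ⟨a⟩ ⊂ (ℤ/pq)^*
(item WorkDigitsEquidistributed, Gauss sums).
Consequence (prose, the kill): a closure simulator whose ≤k-marginals at the post-modexp cut are
accurate holds a-independent data,
and its update through the (a,N)-independent QFT keeps it a-independent — so it outputs the same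
answer for all dark (N,a) and cannot
find r; one that is not accurate fails as a simulator. Closure order must reach c·n/log n (all
marginals) resp. c·n (control) before
Shor's register is visible: cost n^{Θ(k)} = 2^{Ω(n)}.
Lean: `Literature.Computability.Cryptography.BQP ⊆ Literature.Computability.Complexity.BPP`

## Assembly
Pure logic (item Assembly = `ClosureThesis → ¬QuantumAdvantage`, the same shape as Dequantize's
rev-4 and XorDarkCharacters'
assemblies): X = BQP ⊆ BPP alone contradicts the summit ∃ L ∈ BQP ∖ BPP — `fun h0 ⟨L, hL, hnL⟩ =>
hnL (h0 hL)`; the named fact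
BPP ⊆ BQP (BernsteinVazirani1997 §8) is only what lets one read X as the class equality BQP = BPP
and is no longer a hypothesis.
The cruxes are not in the chain: they are the KILLS of the closure road to X, exactly as PauliFlat's
arithmetic items.
Deciding theorem (D-0027 §2.1, glue.lean, --refutation): `theorem closes (h0 : ClosureThesis) (_ :
MixedMarginalsDarkR)
(_ : WorkDigitsEquidistributed) (_ : OrderSparseMultiplesRare) (_ : ControlMarginalFormula) (_ :
SparseMultiplesLinear)
(_ : SparseMultipleExists) (_ : Assembly) : ¬QuantumAdvantage := fun ⟨_, hL, hnL⟩ => hnL (h0 hL)` —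
every active item a hypothesis,
only h0 used.

Rationale: WHY THIS LINE. Dequantize and PauliFlat shoot at stabilizer rank and at Pauli-coefficient
truncation; the third family of modern dequantizers —
correlation-ORDER closures (BP + loop series, cumulant/BBGKY hierarchies, cluster mean field,
marginal SDPs), which defeated the
kicked-Ising utility experiment (TindallEtAl2024, arXiv:2308.05077, arXiv:2409.03108) — has never
been confronted with Shor, and its
blind spot on Shor's register can be computed EXACTLY: by a two-line partial trace
(ControlMarginalFormula) the control marginal on
S is maximally mixed iff S supports no signed-binary multiple of r, i.e. iff |S| is below the
minimum distance of the AN code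
{r·s : |r s| < 4^n} of computer-arithmetic coding theory (Vanlint1992 §12.1, Def. 12.1.1; Chen1974),
and a five-line first moment
with the divisor bound (HardyWright2008 Thm 315) makes that distance ≥ n/20 for typical r (planning
data: median d = 3,3,3,4,4,4,5 for
n = 6..18 matches the first-moment prediction k*(n) exactly; k*(1024) = 175 ≈ 0.17n). Imported
areas: arithmetic codes (AN codes,
arithmetic weight / NAF), multiplicative number theory (divisor bounds, orders mod pq), exponential
sums over subgroups
(Konyagin–Shparlinski isbn:9780521642637 Thm 3.4; BourgainGlibichukKonyagin2006 only if one wants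
small orders) and additive
Fourier analysis of digit cells (Green2012 / Harman–Kátai, in tree as
Literature.NumberTheory.DiophantineApproximation.SparseDyadicRationals).
What it does that prior routes do not: a STATE-side (Schrödinger picture) exact invisibility
threshold with a coding-theory
dictionary (k-RDM maximally mixed ⟺ k < d_AN(r)), complementary to PauliFlat's operator-side κ(a,N);
the negatives index (1
entry, KummerSector) is not touched.

RANKED CRUXES. #0 ClosureThesis (target) — X of routes Dequantize / PauliFlat (shared decl): every
uniform Clifford+T family with error 1/3 is simulable in BPP — here reached (hypothetically) by
correlation-order closure; the route exists for the kills of that road. (why it might fail: X puts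
FACT in BPP (Shor1997) against the oracle evidence BQP^O ⊄ BPP^O; its closure road H_CL is exactly
what items 2–4 kill on order finding.) [BernsteinVazirani1997 §8, Shor1997 §5, arXiv:2306.14887,
card QuantumAdvantage/QuantumAdvantage/shor-is-locally-dark]
#2 MixedMarginalsDarkR (crux; REPAIR 2026-08-15, supersedes MixedMarginalsDark) — ∃ c > 0 ∃ n₀ ∀ n ≥
n₀: for all but ≤ 2^{(2−c)n} pairs (N, a) with N = pq a product of two distinct primes that is
BALANCED, N^{1/3} ≤ p and N^{1/3} ≤ q (hence p, q odd), 2^{n−1} < N < 2^n, a < N a unit: for EVERY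
control subset S ⊆ Fin(2n), work-bit subset T ⊆ Fin n with (|S|+|T|)·log n ≤ c·n and all index
patterns (u,u',b,b'), the reduced-density-matrix entry of |ψ_{a,N}⟩ on S ∪ T — the normalised count
2^{−2n−|S|}·#{y : bits_T(a^x mod N) = b_T, bits_T(a^{x'} mod N) = b'_T, a^x and a^{x'} agree off T},
x = S.piecewise u y, x' = S.piecewise u' y — is within 2^{−(|S|+|T|)}·N^{−c} of the a-INDEPENDENT
reference [u_S = u'_S][b_T = b'_T]·2^{−|S|}·#{z < N : bits_T z = b_T}/N (card K2(ii); balance is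
exactly the hypothesis of WorkDigitsEquidistributed, and unbalanced N = pq are most semiprimes, so
the 2^{(2−c)n} budget could never have absorbed them). [deps: WorkDigitsEquidistributed,
ControlMarginalFormula, OrderSparseMultiplesRare] [difficulty: XL] (why it might fail: balance
removes p = 2 (bit 0 of a^x mod 2q constant) and the small resonant p | 2^P−1, a ≡ 1 (mod p) family;
it may still fail if a balanced family correlates digit cells with ⟨a⟩ mod p beyond N^{−c} at |T| ≍
n/log n despite ord_p(a) ≥ p^{1/2+δ}, or if AN-resonant pairs exceed 2^{(2−c)n} among balanced N.
Planner check at repair: the diagonal blocks do NOT suffer cross-run resonances — the ℓ¹ Fourier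
norm of the uniform measure on {x < 4^n : x_S = u} reduced mod m is ≤ 3(2Cn)^{|S|} for EVERY m ≤ 2^n
— so the proof reduces to twisted subgroup digit sums Σ_{h∈⟨a⟩} χ(h)1_B(h) (Gauss sums mod pq and
mod p, q) plus point masses and the AN-resonant event r | Σ_S ±2^j off the diagonal.)
[Summit.QuantumAdvantage.QuantumAdvantage.Theorems.ShorLocallyDarkMixedMarginalsDark_refuted,
KonyaginShparlinski1999 Thm 3.4 (3.15) =
Literature.NumberTheory.GaussSums.subgroupExpSum_norm_le_sqrt_holds, Green2012 §4 =
Literature.NumberTheory.DiophantineApproximation.HarmanKatai.eq_two_pow_of_sparseDyadic,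
KendonMunro2006, BourgainGlibichukKonyagin2006, Mathlib gaussSum_mul_gaussSum_eq_card]
MixedMarginalsDark (rank 2 at open; SETTLED NEGATIVE EDGE) — REFUTED as typed by
Summit.QuantumAdvantage.QuantumAdvantage.Theorems.ShorLocallyDarkMixedMarginalsDark_refuted
(refuter-rreview-0815T13-1-0): the semiprime clause admitted p = 2; for (N, a) = (2q, 2k+1) with S =
∅, T = {0}, b = b' = 0 the entry is 0 and the reference 1/2, and by Chebyshev's θ-bounds these pairs
number ≥ 2^{2n−7}/(j+1) ≫ 2^{(2−c)n} for every c > 0. Class misstated; repaired by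
MixedMarginalsDarkR (balanced moduli); never re-filed.
#3 OrderSparseMultiplesRare (support since retriage 2026-08-15; was crux) — ∃ c > 0 ∃ n₀ ∀ n ≥ n₀:
#{(N, a) : N = pq < 2^n (distinct primes), a < N unit, and ord_N(a) divides some nonzero
{−1,0,1}-combination of 2^0,…,2^{2n−1} of weight ≤ c·n} ≤ 2^{(2−c)n} — i.e. for typical RSA pairs
the AN-code distance of the PERIOD on 2n positions is linear, so (by ControlMarginalFormula) every
control marginal of Shor's register on ≤ c·n qubits is EXACTLY maximally mixed (card K1, corrected
from n/log n to linear and moved from 'typical odd r' to 'typical order'). [deps: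
SparseMultiplesLinear] [difficulty: M] (why it might fail: Orders lcm(ord_p a, ord_q a) divide λ(N),
they are not uniform integers; the first moment needs Σ_{m≤X} gcd(D,m−1) ≤ 2Xτ(D) and τ(D) ≤
C·D^{1/8} over sparse signed D < 4^n, with one constant c doing triple duty (weight, density, small
orders): on paper 2^{1.89n} ≪ 2^{1.95n}, a thin typed margin.) [Vanlint1992 §12.1 (AN codes,
arithmetic weight, {AN : N ∈ ℤ} has minimum weight ≤ 2), Chen1974 (doi:10.1109/tit.1974.1055199,
wanted acq-02593), HardyWright2008 Thm 315, planner data compute/wm.py (NOTES.md KEY FINDINGS 1)]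
#4 WorkDigitsEquidistributed (crux) — ∀ δ > 0 ∃ c > 0 ∃ n₀ ∀ n ≥ n₀: for N = pq (distinct primes)
with 2^{n−1} < N < 2^n, p, q ≥ N^{1/3}, a unit with ord_p(a) ≥ p^{1/2+δ}, ord_q(a) ≥ q^{1/2+δ}, r =
ord_N(a) ≥ N^{1/2+δ}: for every set T of bit positions with |T|·log n ≤ c·n and pattern b, |#{ℓ < r
: bits_T(a^ℓ mod N) = b}/r − #{z < N : bits_T z = b}/N| ≤ 2^{−|T|}·N^{−c} (the S = ∅ case of
MixedMarginalsDark under deterministic hypotheses; engine: 1_⟨a⟩ expanded in Dirichlet characters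
mod pq, |Gauss sum| ≤ √conductor, digit-cell Fourier algebra norm ≤ (C n²)^{|T|}). [difficulty: L]
(why it might fail: At frequencies ξ ∈ pℤ the saving is only √q/ord_q(a), so digits of ⟨a⟩ ARE
biased at scale 1/p when a ≡ ±1 (mod p) or p is tiny — the hypotheses p,q ≥ N^{1/3}, ord_p(a) ≥
p^{1/2+δ} are exactly the proof's needs; the cell algebra norm (Cn²)^{|T|} caps |T| at n/log n,
possibly not sharp.) [isbn:9780521642637 (Konyagin–Shparlinski 1999, Thm 3.4 (3.15): S(q, V) ≤
Nm(q)^{1/2}), BourgainGlibichukKonyagin2006, Bourgain GAFA 15 (2005) 1–34 (Diffie–Hellman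
distributions), Mathlib gaussSum_mul_gaussSum_eq_card, Green2012 §4]
#9 ControlMarginalFormula (support) — THE LEMMA (exact, provable now): for 1 < N, gcd(a,N) = 1, any
m, S ⊆ Fin m and control patterns u, u': #{y : Fin m → Bool : a^{ofBits(S.piecewise u y)} ≡
a^{ofBits(S.piecewise u' y)} (mod N)} = 2^m·[ord_N(a) ∣ Σ_{j∈S}(u_j − u'_j)2^j] (else 0); hence ρ_S
= 2^{−|S|}·1 iff S supports no signed-binary multiple of ord_N(a) — the control register is
(d_AN(r)−1)-locally maximally mixed, for every m (no 2^m ≫ r needed). Proof: a^x ≡ a^{x'} ⟺ x ≡ x'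
[MOD orderOf a] (Mathlib pow_eq_pow_iff_modEq) and x − x' = Σ_{j∈S}(u_j−u'_j)2^j is independent of
y. [difficulty: provable-now] [KendonMunro2006 (numerics: subsystem entropies maximal, N = 15, 21),
NielsenChuang2010 §5.3, Vanlint1992 Def. 12.1.1]
#9 SparseMultiplesLinear (support) — the clean number-theory form of K1 (random generator of a
rate-1/2 binary AN code has linear arithmetic distance): ∃ c > 0 ∃ n₀ ∀ n ≥ n₀: #{r < 2^n odd : some
nonzero {−1,0,1}-combination of 2^0..2^{2n−1} of weight ≤ c·n is divisible by r} ≤ 2^{(1−c)n}. Proof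
found at planning (NOTES.md): union over the ≤ n(4en/w)^w patterns, each nonzero value D (|D| < 4^n)
has ≤ τ(D) ≤ C·4^{n/4} divisors; c = 1/20 gives 2^{0.94n} < 2^{0.95n}. [difficulty: M] [Vanlint1992
§12.1, Chen1974, HardyWright2008 Thm 315, compute/wm.py]
#9 SparseMultipleExists (support) — calibration from above (pigeonhole, provable now): every 0 < r <
2^n divides a nonzero {−1,0,1}-combination of 2^0..2^{2n−1} of weight ≤ n + 1 (0/1 vectors of weight
⌈n/2⌉ on 2n positions number C(2n,⌈n/2⌉) ≥ 2^n > r; subtract two with equal residue). So the dark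
order of the control register is Θ(n), never more (asymptotically ≤ 0.44n; heuristically
(0.168+o(1))n, root of H(x)+x = 1/2). [difficulty: provable-now] [Vanlint1992 §12.1 (Problem
12.5.1), folklore pigeonhole]

TWO-LAYER PLAN. Foreseen glued splits (nothing filed now): MixedMarginalsDarkR ⇐
DigitalSumEquidistribution (ℓ¹ Fourier norm of the uniform measure
on {x < 4^n : x_S = u} reduced mod m is ≤ 3(2Cn)^{|S|} for EVERY m ≤ 2^n — repair-time planner
check: expand the |S| bit indicators (A-norm O(j) each) and sum the geometric series over x < 4^n
against the spacing 1/m ≥ 2^{−n}) → TwistedCellSums (|Σ_{h∈⟨a⟩} χ(h)1_B(h)| ≤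
(Cn²)^{|T|}·max(√N, r√p/ord_p a, r√q/ord_q a) for χ ≠ 1 on ⟨a⟩, plus the off-diagonal point-mass /
(a^D−1)h ≡ E analysis) → MixedMarginalsDarkR (exceptional pairs: small ord_p a, ord_q a, large
gcd(p−1,q−1), r | sparse D — all power-saving few among balanced N). OrderSparseMultiplesRare ⇐
PerPatternFewOrders
(for each sparse D: #{(p,q,a) : a^D ≡ 1 mod pq, pq < 2^n} ≤ 2^{n+1}(n+1)τ(D)²) → DivisorBoundEighth
(τ(D) ≤ C·D^{1/8}) →
OrderSparseMultiplesRare. WorkDigitsEquidistributed ⇐ SubgroupSumModPQ (max_{ξ≢0}|Σ_{h∈⟨a⟩}e_N(ξh)|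
≤ max(√N, r√q/ord_q a,
r√p/ord_p a)) → DigitCellAlgebraNorm (‖1_B‖_{A(ℤ/N)} ≤ (Cn²)^{|T|}) → WorkDigitsEquidistributed.

KILL CRITERIA. MixedMarginalsDark (unbalanced) IS refuted — by the p = 2 degeneracy, a typing slip
(class misstated), repaired 2026-08-15 as MixedMarginalsDarkR
(balanced N). MixedMarginalsDarkR refuted by a positive-density BALANCED family of resonant (N, a,
S, T) with ord_p(a), ord_q(a) ≥ (·)^{1/2+δ} → 'locally dark'
survives for control-only marginals (items 3, 9) and the kill shrinks to closures blind to the work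
register: restate with |S|+|T| = O(1) once;
if that dies too, close refuted:MixedMarginalsDarkR. A refutation of MixedMarginalsDarkR through
budget arithmetic alone (small-order or
AN-resonant pairs outnumbering 2^{(2−c)n} for every c) is again a typing slip: restate with the
order hypotheses of WorkDigitsEquidistributed explicit. OrderSparseMultiplesRare refuted (orders
systematically AN-light) → control darkness only to the order
given by data; route keeps rank 2/4 at order n/log n but loses its headline; SparseMultiplesLinear
refuted is impossible modulo my
arithmetic (first moment) — a refutation there means a typing slip: restate.
WorkDigitsEquidistributed refuted as typed → restate
hypotheses (balance / per-prime orders); refuted in substance (digits of large subgroups mod pq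
biased at scale N^{-c}) → ranks 2 and
4 both die: close. A closure-type method in print that tracks Shor's order finding with poly
resources kills the card's point (none
known; MPS needs bond dimension r). ClosureThesis PROVED (nobody expects it) → X and ¬S, mooting
every positive route.

NOT DECOMPOSED YET. The consumer dichotomy over a posited `OrderKClosureSimulator` interface
(accurate ≤k-marginals at the cut ⇒ a-independent output
through the (a,N)-independent QFT ⇒ no factoring) — near-tautological given items 2–3, deliberately
not an item; early modexp stages
(work register a mixture of few a^x: NOT dark, irrelevant to the dichotomy); post-QFT k-wise
near-uniformity of Shor's output
distribution (card K2(iii), a Sturmian/Diophantine statement, not load-bearing); the sharp constant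
d(r) = (0.168+o(1))n (second
moment over pattern pairs); the small-order regime N^δ < r < N^{1/2} (needs
BourgainGlibichukKonyagin2006 / Bourgain 2005 for
composite moduli); prime-power and unbalanced N; Kitaev's one-control-qubit variant (marginals in
time rather than space — cf. card
prony-meets-shor-temporal-entanglement).

CHEAPEST FALSIFIER. (i) kit census of d(ord_N(a)) on 2n positions for random RSA pairs, n ≤ 40
(numpy/C DP, O(n·r) per pair): first-moment prediction
k*(n) = 3,3,4,4,4,5,5 (n = 6..18, CONFIRMED locally this session for random odd r, compute/wm.py, 30
samples each: medians 3,3,3,4,4,4,5)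
and k*(24,32,40) = 6,7,9 — medians ≤ 5 at n = 40 would break the linear law for orders. (ii) Exact
small-instance check of
MixedMarginalsDarkR: n ≤ 11, N = pq balanced (p, q ≥ N^{1/3}, so odd), 20 random a, all (S,T) with
|S|+|T| ≤ 3: max relative entry deviation, expected ≲ N^{-1/4};
an Ω(1) deviation at |S| = 2 kills rank 2 as stated. (iii) Lookup Chen1974 (acq-02593): an
asymptotic bound for arithmetic codes
contradicting linear distance at rate 1/2 for MOST generators would contradict the five-line first
moment — i.e. would expose an
error in NOTES.md KEY FINDINGS 1 (c·log₂(4e/c) + 1/2 + c = 0.94 < 0.95 at c = 1/20).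

NUMBERS. Dark order of the control register = d(r) − 1, d(r) = AN-code distance of r on 2n
positions. Heuristic/first moment: d ≈ 2n·x*,
H(x*) + x* = 1/2, x* = 0.08397 → 0.168n; pigeonhole ceiling 2⌈n/2⌉ ≤ n+1 (asymptotically 0.44n, H(x)
= 1/2 at x = 0.110).
First-moment prediction k*(n) = min{k : C(2n−1,k−1)2^{k−1} ≥ 2^{n−1/2}}: 3,3,4,4,4,5,5 (n=6..18), 6
(24), 7 (32), 9 (40), 13 (64),
24 (128), 45 (256), 88 (512), 175 (1024); local data (compute/wm.py, random odd r ∈ (2^{n−1},2^n),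
30 per n): n=6 {2:14,3:16},
8 {2:6,3:23,4:1}, 10 {2:1,3:16,4:13}, 12 {3:7,4:23}, 14 {2:1,4:18,5:11}, 16 {4:17,5:13}, 18
{4:5,5:25}; structured r = 2^n ± 1 → 2,
3^7 → 4 (card). Rigorous lower-bound constant: c = 1/20 with τ(D) ≤ C·D^{1/4} (exponent 0.938 <
0.95); for orders c = 1/20 with
τ(D) ≤ C·D^{1/8} (1.89 < 1.95). Work/mixed side: digit-cell algebra norm (Cn²)^{|T|}, subgroup-sum
saving N^{-δ/3}, whence
|T| ≲ δn/(12 log₂ n). Items at open: 8 (3 cruxes); after retriage + repair (2026-08-15): 9 decls of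
which MixedMarginalsDark is refuted/settled, 2 active cruxes (MixedMarginalsDarkR r2,
WorkDigitsEquidistributed r4), target, assembly, 4 supports.

DEFINITION REQUESTS. None filed: every statement is inline over Mathlib (Nat.ofBits,
Finset.piecewise, orderOf in ZMod N, Nat.testBit, Finset.filter/card);
reduced density matrices are written as normalised counts (the state is a uniform superposition of
distinct basis vectors), so no
partial-trace API is needed. The simulator interface `OrderKClosureSimulator` (card D1) is
deliberately NOT posited at open (see Not
decomposed yet). Literature want filed automatically: acq-02593 (Chen1974, IEEE IT-20).

Novelty: Searches (2026-08-15): `lit galaxy search "low-weight multiples" --star all` (6 rows: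
LFSR/stream-cipher low-weight POLYNOMIAL multiples, CRYPTO/SAC volumes — no integer/AN link to
Shor); `lit galaxy search "arithmetic weight of multiples" --star all` (0); `lit search "AN codes
arithmetic codes minimum arithmetic distance Gilbert-Varshamov bound"` (local 15 + zbmath/crossref
20: found Chen1974 doi:10.1109/tit.1974.1055199 'An asymptotic bound on the distance of arithmetic
codes' → lit read rc 3, want acq-02593); `lit search --hybrid --source local "AN code arithmetic
weight modular distance Mandelbaum Barrows"` (van Lint 1992 ch. 12 READ pp. 231–239: Def. 12.1.1
arithmetic weight, AN codes, NAF Thm 12.2.3, 'H = {AN} has minimum weight ≤ 2'); `lit galaxy search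
--title-contains "Character sums with exponential functions"` + `lit galaxy read
panama:278468499603529` (Konyagin–Shparlinski: Thm 3.4 (3.15) S(q,V) ≤ Nm(q)^{1/2} READ p.14; ch. 11
bits of u_n ≡ λu_{n−1} READ p.52); `lit search --source arxiv "entanglement Shor algorithm reduced
density matrix"` (1 irrelevant), `"belief propagation tensor network simulation Shor algorithm order
finding"` (0); `lit search --hybrid --source local "Shor algorithm entanglement marginal maximally
mixed register"` (12 textbooks, nothing specific); lean search (tree):
Literature.NumberTheory.DiophantineApproximation.SparseDyadicRationals (Green2012 §4 / Harman–Kátai,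
PROVED) is the nearest in-tree tool; plus the card's and the audit's sweeps  [refs: 10.1109/tit.1974.1055199, 10.26421/qic6.7-6:, 2306.14887, doi:10.1109/tit.1974.1055199, doi:10.26421/qic6.7-6, isbn:9780521642637, Chen1974, Green2012, KendonMunro2006, Vanlint1992, BourgainGlibichukKonyagin2006, TindallEtAl2024]

Barriers (technique_class: simulation-lower-bound, exponential-sums, method-kill): - technique_class: simulation-lower-bound, exponential-sums, method-kill
- Literature.Barriers.QuantumAdvantage.Relativization: evaded in kind, as Dequantize/PauliFlat —
every item is a statement about the explicit arithmetic state Σ_x|x⟩|a^x mod N⟩ (counts of bit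
patterns, orders mod pq, divisibility of signed dyadic sums); an oracle gate has no such state to
analyse and H_CL says nothing about BQP^O; the Assembly is the shared antisymmetry line and claims
no separation.
- Literature.Barriers.QuantumAdvantage.Algebrization: same verdict (no oracle-inclusion argument, no
arithmetization; Algebrization constrains proofs of BQP ⊆ BPP of shape C^A ⊆ D^Ã, not kills of a
simulator class on one family).
- Literature.Barriers.QuantumAdvantage.NaturalProofs: n/a — darkness of ONE explicit family of
states is not a dense constructive property used against P/poly; no circuit lower bound is claimed.
- Literature.Barriers.QuantumAdvantage.NoiseThresholdUpperBounds: adjacent only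
(kempeRegevUngerDeWolf2008_thm1 concerns noisy circuits; nothing here is about noise). The companion
island files of the catalogue directory are where this route actually sits, all CONSISTENT:
UncorrectedNoise.lean (bremnerMontanaroShepherd2017_thm4-type results: noise damps high-order
correlations, which is why closures dequantize noisy devices, while Shor's information is ONLY
high-order — the kills are for the noiseless witness); BoundedEntanglement.lean
(jozsaLinden2003_pblocked: a witness needs unboundedly l

History (route lifecycle, newest last):
- 2026-08-15T15:13:35Z · BROKEN — MixedMarginalsDark (stmt-QuantumAdvantage-8592, crux) refuted by Summit.QuantumAdvantage.QuantumAdvantage.Theorems.ShorLocallyDarkMixedMarginalsDark_refuted (refuter-rreview-0815T13-1-0)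
- 2026-08-15T16:19:02Z · rev 3: restated Assembly (stmt-QuantumAdvantage-0243) — repair: MixedMarginalsDark (stmt-QuantumAdvantage-8592) refuted-misstated by Summit.QuantumAdvantage.QuantumAdvantage.Theorems.ShorLocallyDarkMixedMarginalsDark (planner-rrefute-QuantumAdvantage-ShorLocallyDa-226eb033-g4-0)
- 2026-08-15T16:21:40Z · rev 4: dropped MixedMarginalsDark — repair (clear BROKEN): MixedMarginalsDark (stmt-QuantumAdvantage-8592) is not load-bearing any more — REFUTED as typed by Summit.QuantumAdvantage.QuantumAdvanta (planner-rrefute-QuantumAdvantage-ShorLocallyDa-226eb033-g4-0)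
- 2026-08-15T16:21:40Z · REPAIRED (drop MixedMarginalsDark) — back to open: repair (clear BROKEN): MixedMarginalsDark (stmt-QuantumAdvantage-8592) is not load-bearing any more — REFUTED as typed by Summit.QuantumAdvantage.QuantumAdvanta (planner-rrefute-QuantumAdvantage-ShorLocallyDa-226eb033-g4-0)
- 2026-08-16T04:15:15Z · AUTO-CRUX (backfill): ClosureThesis — hypotheses of the deciding theorem that nothing in the route derives are cruxes (operator:999:1085951)
- 2026-08-26T14:17:34Z · DORMANT — reconciler: no traction for 6.7 d (last activity item-proof-filed at 2026-08-19T20:57:09Z); parked, not closed — `ledger route dormant route-QuantumAdvantage-Sh (operator:999:1639170)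

sub-problem: QuantumAdvantage · status: dormant · opened planner-plancard-QuantumAdvantage-QuantumAdva-98a3177c-0 2026-08-15T13:16:08Z · rev 3 · ledger route-QuantumAdvantage-ShorLocallyDark
GENERATED by the gate from the ledger (D-0016/17). Provers cite these decls: `theorem foo : Summit.QuantumAdvantage.QuantumAdvantage.Theses.ShorLocallyDark.<Decl> := …` in Summits/QuantumAdvantage/QuantumAdvantage/Theorems/<Name>.lean.
-/

namespace Summit.QuantumAdvantage.QuantumAdvantage.Theses.ShorLocallyDark

open scoped BigOperators Topology Manifold Classical MeasureTheory ProbabilityTheory Matrix InnerProductSpace ComplexConjugate ContinuousMap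
open Filter Set Function TopologicalSpace MeasureTheory

attribute [summit_statement] _root_.QuantumAdvantage

open Literature.QuantumAdvantage

/-- item stmt-QuantumAdvantage-0242 · crux (kind.auto-crux: conjecture-grade) · rank 0 · open · by planner
why it might fail: X = BQP ⊆ BPP puts FACTORING in BPP (Shor1997 §5) against the relativized evidence BQP^O ⊄ BPP^O (BernsteinVazirani1997); nobody expects a proof — the route exists for the kills of the closure road H_CL (items 2, 4), X itself is never staffed.
sources: BernsteinVazirani1997 §8, Shor1997 §5, arXiv:2306.14887, BravyiGosset2016
Thesis X of route Dequantize, targeting ¬QuantumAdvantage (quantum-advantage.S02, BQP = BPP): every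
uniform Clifford+T family with error 1/3 is simulable in BPP. [BernsteinVazirani1997 §8;
BravyiGosset2016] -/
@[route_item "route-QuantumAdvantage-ShorLocallyDark", crux]
def ClosureThesis : Prop :=
  Literature.Computability.Cryptography.BQP ⊆ Literature.Computability.Complexity.BPP

/-- item stmt-QuantumAdvantage-10381 · aside · rank 2 · open · by planner
why it might fail: Balance removes p = 2 (bit 0 of a^x mod 2q constant) and small resonant p | 2^P−1, a ≡ 1 (mod p); may still fail if a balanced family correlates digit cells with ⟨a⟩ mod p beyond N^{−c} at |T| ≍ n/log n despite ord_p(a) ≥ p^{1/2+δ}, or if AN-resonant pairs exceed 2^{(2−c)n} for balanced N.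
sources: Summit.QuantumAdvantage.QuantumAdvantage.Theorems.ShorLocallyDarkMixedMarginalsDark_refuted (p = 2 witness of the unbalanced predecessor), KonyaginShparlinski1999 Thm 3.4 (3.15) = Literature.NumberTheory.GaussSums.subgroupExpSum_norm_le_sqrt_holds / cyclicExpSum_norm_le_sqrt, Green2012 §4 = Literature.NumberTheory.DiophantineApproximation.HarmanKatai.eq_two_pow_of_sparseDyadic, KendonMunro2006, BourgainGlibichukKonyagin2006, Mathlib gaussSum_mul_gaussSum_eq_card
[crux] repaired MixedMarginalsDark (stmt-QuantumAdvantage-8592 was refuted AS TYPED by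
Summit.QuantumAdvantage.QuantumAdvantage.Theorems.ShorLocallyDarkMixedMarginalsDark_refuted: the
semiprime clause admitted p = 2, and for N = 2q bit 0 of a^x mod N is constant, so ~4^n/(16 n ln 2)
pairs are exceptional). SAME claim over BALANCED RSA moduli only: ∃ c > 0 ∃ n₀ ∀ n ≥ n₀: among pairs
(N, a) with N = pq, p ≠ q primes, N^{1/3} ≤ p, N^{1/3} ≤ q (hence p, q odd), 2^{n−1} < N < 2^n, a <
N a unit, all but ≤ 2^{(2−c)n} satisfy: for EVERY control set S ⊆ Fin(2n), work-bit set T ⊆ Fin n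
with (|S|+|T|)·log n ≤ c·n and all patterns (u,u',b,b'), the reduced-density-matrix entry of
|ψ_{a,N}⟩ = 2^{-n}Σ_{x<4^n}|x⟩|a^x mod N⟩ on S ∪ T (the normalised count 2^{−2n−|S|}·#{y :
bits_T(a^x mod N) = b, bits_T(a^{x'} mod N) = b', a^x ≡ a^{x'} off T}, x = S.piecewise u y, x' =
S.piecewise u' y) is within 2^{−(|S|+|T|)}·N^{−c} of the a-INDEPENDENT reference [u_S = u'_S][b_T =
b'_T]·2^{−|S|}·#{z < N : bits_T z = b}/N. Balance is exactly the hypothesis of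
WorkDigitsEquidistributed and also excludes the unbalanced resonant family p | 2^P−1 (P small), a ≡
1 (mod p) (digit-sum bias mod p) flagged at retriage. Pro -/
@[route_item "route-QuantumAdvantage-ShorLocallyDark", crux]
def MixedMarginalsDarkR : Prop :=
  ∃ c : ℝ, 0 < c ∧ ∃ n₀ : ℕ, ∀ n ≥ n₀, (((Finset.range (2 ^ n) ×ˢ Finset.range (2 ^ n)).filter fun Na : ℕ × ℕ => (∃ p q : ℕ, p.Prime ∧ q.Prime ∧ p ≠ q ∧ Na.1 = p * q ∧ (Na.1 : ℝ) ^ (1 / 3 : ℝ) ≤ p ∧ (Na.1 : ℝ) ^ (1 / 3 : ℝ) ≤ q) ∧ 2 ^ (n - 1) < Na.1 ∧ Na.2 < Na.1 ∧ Nat.Coprime Na.2 Na.1 ∧ ∃ (S : Finset (Fin (2 * n))) (T : Finset (Fin n)) (u u' : Fin (2 * n) → Bool) (b b' : Fin n → Bool), ((S.card + T.card : ℕ) : ℝ) * Real.log n ≤ c * n ∧ (2 : ℝ) ^ (-((S.card + T.card : ℕ) : ℝ)) * (Na.1 : ℝ) ^ (-c) < |((((Finset.univ : Finset (Fin (2 *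 n) → Bool)).filter fun y => (∀ i ∈ T, (Na.2 ^ Nat.ofBits (S.piecewise u y) % Na.1).testBit (i : ℕ) = b i) ∧ (∀ i ∈ T, (Na.2 ^ Nat.ofBits (S.piecewise u' y) % Na.1).testBit (i : ℕ) = b' i) ∧ (∀ i : Fin n, i ∉ T → (Na.2 ^ Nat.ofBits (S.piecewise u y) % Na.1).testBit (i : ℕ) = (Na.2 ^ Nat.ofBits (S.piecewise u' y) % Na.1).testBit (i : ℕ))).card : ℝ) / (2 : ℝ) ^ (2 * n + S.card)) - (if (∀ j ∈ S, u j = u' j) ∧ (∀ i ∈ T, b i = b' i) then (((Finset.range Na.1).filter fun z => ∀ i ∈ T, z.testBit (i : ℕ) = b i).card : ℝ) / ((Na.1 : ℝ) * (2 : ℝ) ^ S.card) else 0)|).card : ℝ) ≤ (2 : ℝ) ^ ((2 - c) * n)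

/-- item stmt-QuantumAdvantage-8593 · support · rank 3 · open · by planner
why it might fail: Orders lcm(ord_p a, ord_q a) divide λ(N), they are not uniform integers; the first moment needs Σ_{m≤X} gcd(D,m−1) ≤ 2Xτ(D) and τ(D) ≤ C·D^{1/8} over sparse signed D < 4^n, with one constant c doing triple duty (weight, density, small orders): on paper 2^{1.89n} ≪ 2^{1.95n}, a thin typed margin.
sources: Vanlint1992 §12.1, HardyWright2008 Thm 315 = Literature.NumberTheory.Sieve.exists_card_divisors_le_mul_rpow, Chen1974 (acq-02593)
[crux] ∃ c > 0 ∃ n₀ ∀ n ≥ n₀: #{(N, a) : N = pq < 2^n (distinct primes), a < N unit, and ord_N(a)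
divides some nonzero {−1,0,1}-combination of 2^0,…,2^{2n−1} of weight ≤ c·n} ≤ 2^{(2−c)n} — i.e. for
typical RSA pairs the AN-code distance of the PERIOD on 2n positions is linear, so (by
ControlMarginalFormula) every control marginal of Shor's register on ≤ c·n qubits is EXACTLY
maximally mixed (card K1, corrected from n/log n to linear and moved from 'typical odd r' to
'typical order'). [deps: SparseMultiplesLinear] [difficulty: M] -/
@[route_item "route-QuantumAdvantage-ShorLocallyDark", crux]
def OrderSparseMultiplesRare : Prop :=
  ∃ c : ℝ, 0 < c ∧ ∃ n₀ : ℕ, ∀ n ≥ n₀, (((Finset.range (2 ^ n) ×ˢ Finset.range (2 ^ n)).filter fun Na : ℕ × ℕ => (∃ p q : ℕ, p.Prime ∧ q.Prime ∧ p ≠ q ∧ Na.1 = p * q) ∧ Na.2 < Na.1 ∧ Nat.Coprime Na.2 Na.1 ∧ ∃ ε : Fin (2 * n) → ℤ, (∀ j, ε j = -1 ∨ ε j = 0 ∨ ε j = 1) ∧ ε ≠ 0 ∧ ((Finset.univ.filter fun j => ε j ≠ 0).card : ℝ) ≤ c * n ∧ ((orderOf ((Na.2 : ℕ) : ZMod Na.1)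 : ℕ) : ℤ) ∣ ∑ j, ε j * 2 ^ (j : ℕ)).card : ℝ) ≤ (2 : ℝ) ^ ((2 - c) * n)

/-- item stmt-QuantumAdvantage-8594 · aside · rank 4 · open · by planner
why it might fail: For |T| ≍ n/log n every free run has 2^L = n^{O(1)} ≪ √p, so the engine's bound (ℓ¹ Fourier bias of the cell mod p)·√p/ord_p(a) is ≫ 1; one needs few t with t·2^o mod p small at all run offsets at once — unclear for structured p | k·2^j±k′ (not excluded); may force |T| ≤ √n or a clause on p.
sources: KonyaginShparlinski1999 Thm 3.4 (3.15) and Thm 11.4, BourgainGlibichukKonyagin2006, Gelfond1968, Green2012 §4 = Literature.NumberTheory.DiophantineApproximation.HarmanKatai.eq_two_pow_of_sparseDyadic, Mathlib gaussSum_mul_gaussSum_eq_card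
[crux] ∀ δ > 0 ∃ c > 0 ∃ n₀ ∀ n ≥ n₀: for N = pq (distinct primes) with 2^{n−1} < N < 2^n, p, q ≥
N^{1/3}, a unit with ord_p(a) ≥ p^{1/2+δ}, ord_q(a) ≥ q^{1/2+δ}, r = ord_N(a) ≥ N^{1/2+δ}: for every
set T of bit positions with |T|·log n ≤ c·n and pattern b, |#{ℓ < r : bits_T(a^ℓ mod N) = b}/r − #{z
< N : bits_T z = b}/N| ≤ 2^{−|T|}·N^{−c} (the S = ∅ case of MixedMarginalsDark under deterministic
hypotheses; engine: 1_⟨a⟩ expanded in Dirichlet characters mod pq, |Gauss sum| ≤ √conductor,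
digit-cell Fourier algebra norm ≤ (C n²)^{|T|}). [difficulty: L] -/
@[route_item "route-QuantumAdvantage-ShorLocallyDark", crux]
def WorkDigitsEquidistributed : Prop :=
  ∀ δ : ℝ, 0 < δ → ∃ c : ℝ, 0 < c ∧ ∃ n₀ : ℕ, ∀ n ≥ n₀, ∀ p q a : ℕ, p.Prime → q.Prime → p ≠ q → 2 ^ (n - 1) < p * q → p * q < 2 ^ n → ((p * q : ℕ) : ℝ) ^ (1 / 3 : ℝ) ≤ p → ((p * q : ℕ) : ℝ) ^ (1 / 3 : ℝ) ≤ q → Nat.Coprime a (p * q) → (p : ℝ) ^ (1 / 2 + δ) ≤ orderOf (a : ZMod p) → (q : ℝ) ^ (1 / 2 + δ) ≤ orderOf (a : ZMod q) → ((p * q : ℕ) : ℝ) ^ (1 / 2 + δ) ≤ orderOf (a : ZMod (p * q)) → ∀ (T : Finset (Fin n)) (b : Fin n → Bool), (T.card : ℝ) * Real.log n ≤ c * n → |((((Finset.range (orderOf (a : ZMod (p * q)))).filter fun ℓ => ∀ i ∈ T, (a ^ ℓ % (p * q)).testBit (i : ℕ) = b i).card : ℝ) / (orderOf (a : ZMod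 (p * q)) : ℝ)) - ((((Finset.range (p * q)).filter fun z => ∀ i ∈ T, z.testBit (i : ℕ) = b i).card : ℝ) / ((p * q : ℕ) : ℝ))| ≤ (2 : ℝ) ^ (-(T.card : ℝ)) * ((p * q : ℕ) : ℝ) ^ (-c)

/-- item stmt-QuantumAdvantage-8595 · support · rank 9 · closed · proved by Summit.QuantumAdvantage.QuantumAdvantage.Theorems.ControlMarginalFormula.controlMarginalFormula_proof @ cddbd7f09411 (prover) · by planner
sources: KendonMunro2006 (numerics: subsystem entropies maximal, N = 15, 21), NielsenChuang2010 §5.3, Vanlint1992 Def. 12.1.1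
[support] THE LEMMA (exact, provable now): for 1 < N, gcd(a,N) = 1, any m, S ⊆ Fin m and control
patterns u, u': #{y : Fin m → Bool : a^{ofBits(S.piecewise u y)} ≡ a^{ofBits(S.piecewise u' y)} (mod
N)} = 2^m·[ord_N(a) ∣ Σ_{j∈S}(u_j − u'_j)2^j] (else 0); hence ρ_S = 2^{−|S|}·1 iff S supports no
signed-binary multiple of ord_N(a) — the control register is (d_AN(r)−1)-locally maximally mixed,
for every m (no 2^m ≫ r needed). Proof: a^x ≡ a^{x'} ⟺ x ≡ x' [MOD orderOf a] (Mathlib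
pow_eq_pow_iff_modEq) and x − x' = Σ_{j∈S}(u_j−u'_j)2^j is independent of y. [difficulty:
provable-now] -/
@[route_item "route-QuantumAdvantage-ShorLocallyDark", crux]
def ControlMarginalFormula : Prop :=
  ∀ (m N a : ℕ), 1 < N → Nat.Coprime a N → ∀ (S : Finset (Fin m)) (u u' : Fin m → Bool), ((Finset.univ : Finset (Fin m → Bool)).filter fun y => a ^ Nat.ofBits (S.piecewise u y) % N = a ^ Nat.ofBits (S.piecewise u' y) % N).card = if ((orderOf (a : ZMod N) : ℤ) ∣ ∑ j ∈ S, (((u j).toNat : ℤ) - (u' j).toNat) * 2 ^ (j : ℕ)) then 2 ^ m else 0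

-- `ControlMarginalFormula` holds: proved by `Summit.QuantumAdvantage.QuantumAdvantage.Theorems.ControlMarginalFormula.controlMarginalFormula_proof` @ cddbd7f09411 (its module imports this route file, so no `_holds` link can be stated here).

/-- item stmt-QuantumAdvantage-8596 · support · rank 9 · open · by planner
sources: Vanlint1992 §12.1, Chen1974, HardyWright2008 Thm 315, compute/wm.py
[support] the clean number-theory form of K1 (random generator of a rate-1/2 binary AN code has
linear arithmetic distance): ∃ c > 0 ∃ n₀ ∀ n ≥ n₀: #{r < 2^n odd : some nonzero
{−1,0,1}-combination of 2^0..2^{2n−1} of weight ≤ c·n is divisible by r} ≤ 2^{(1−c)n}. Proof found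
at planning (NOTES.md): union over the ≤ n(4en/w)^w patterns, each nonzero value D (|D| < 4^n) has ≤
τ(D) ≤ C·4^{n/4} divisors; c = 1/20 gives 2^{0.94n} < 2^{0.95n}. [difficulty: M] -/
@[route_item "route-QuantumAdvantage-ShorLocallyDark", crux]
def SparseMultiplesLinear : Prop :=
  ∃ c : ℝ, 0 < c ∧ ∃ n₀ : ℕ, ∀ n ≥ n₀, (((Finset.range (2 ^ n)).filter fun r => Odd r ∧ ∃ ε : Fin (2 * n) → ℤ, (∀ j, ε j = -1 ∨ ε j = 0 ∨ ε j = 1) ∧ ε ≠ 0 ∧ ((Finset.univ.filter fun j => ε j ≠ 0).card : ℝ) ≤ c * n ∧ (r : ℤ) ∣ ∑ j, ε j * 2 ^ (j : ℕ)).card : ℝ) ≤ (2 : ℝ) ^ ((1 - c) * n)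

/-- item stmt-QuantumAdvantage-8597 · support · rank 9 · closed · proved by Summit.QuantumAdvantage.QuantumAdvantage.Theorems.ShorLocallyDark.sparseMultipleExists_proof @ 52ad445ed26b (prover) · by planner
sources: Vanlint1992 §12.1 (Problem 12.5.1), folklore pigeonhole
[support] calibration from above (pigeonhole, provable now): every 0 < r < 2^n divides a nonzero
{−1,0,1}-combination of 2^0..2^{2n−1} of weight ≤ n + 1 (0/1 vectors of weight ⌈n/2⌉ on 2n positions
number C(2n,⌈n/2⌉) ≥ 2^n > r; subtract two with equal residue). So the dark order of the control
register is Θ(n), never more (asymptotically ≤ 0.44n; heuristically (0.168+o(1))n, root of H(x)+x =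
1/2). [difficulty: provable-now] -/
@[route_item "route-QuantumAdvantage-ShorLocallyDark", crux]
def SparseMultipleExists : Prop :=
  ∀ n r : ℕ, 1 ≤ n → 0 < r → r < 2 ^ n → ∃ ε : Fin (2 * n) → ℤ, (∀ j, ε j = -1 ∨ ε j = 0 ∨ ε j = 1) ∧ ε ≠ 0 ∧ (Finset.univ.filter fun j => ε j ≠ 0).card ≤ n + 1 ∧ (r : ℤ) ∣ ∑ j, ε j * 2 ^ (j : ℕ)

-- `SparseMultipleExists` holds: proved by `Summit.QuantumAdvantage.QuantumAdvantage.Theorems.ShorLocallyDark.sparseMultipleExists_proof` @ 52ad445ed26b (its module imports this route file, so no `_holds` link can be stated here).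

-- earlier Assembly (stmt-QuantumAdvantage-0243, replaced 2026-08-15T16:19:02Z -> stmt-QuantumAdvantage-10594): retired by None — Literature.Computability.QuantumComplexity.BPP_subset_BQP → Literature.Computability.Cryptography.BQP ⊆ Literature.Computability.Complexity.BPP → ¬ QuantumAdvantage
/-- item stmt-QuantumAdvantage-10594 · assembly · rank 1 · closed · proved by Summit.QuantumAdvantage.QuantumAdvantage.Theorems.ShorLocallyDark.Assembly_proof @ e68822b1b33e (prover) · by planner
sources: BernsteinVazirani1997 §8
[assembly] X → ¬Statement by pure logic: the summit `QuantumAdvantage := ∃ L, L ∈ BQP ∧ L ∉ BPP` is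
refuted directly by X = ClosureThesis (BQP ⊆ BPP), `fun h0 ⟨L, hL, hnL⟩ => hnL (h0 hL)`. Rev-3
restatement (route-repair 2026-08-15): the rev-1 form (shared stmt-QuantumAdvantage-0243) carried
the named fact Literature.Computability.QuantumComplexity.BPP_subset_BQP and the inline proposition
BQP ⊆ BPP as hypotheses — glue.extra-hypothesis and an unproved cite-only constant in the cone; both
removed, exactly as Dequantize rev 4 (stmt-QuantumAdvantage-10385). The deciding theorem is `closes
: ClosureThesis → MixedMarginalsDarkR → WorkDigitsEquidistributed → OrderSparseMultiplesRare →
ControlMarginalFormula → SparseMultiplesLinear → SparseMultipleExists → Assembly → ¬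
QuantumAdvantage`; this item is its documentary frame and is provable now by one line. [sources:
BernsteinVazirani1997 §8, Aaronson2010 §1] [difficulty: provable-now] -/
@[route_item "route-QuantumAdvantage-ShorLocallyDark", crux]
def Assembly : Prop :=
  ClosureThesis → ¬ QuantumAdvantage

-- `Assembly` holds: proved by `Summit.QuantumAdvantage.QuantumAdvantage.Theorems.ShorLocallyDark.Assembly_proof` @ e68822b1b33e (its module imports this route file, so no `_holds` link can be stated here).

-- records of items no longer active in this route (dropped / restated):
-- earlier MixedMarginalsDark (stmt-QuantumAdvantage-8592, dropped 2026-08-15T16:21:40Z): refuted by Summit.QuantumAdvantage.QuantumAdvantage.Theorems.ShorLocallyDarkMixedMarginalsDark_refuted — ∃ c : ℝ, 0 < c ∧ ∃ n₀ : ℕ, ∀ n ≥ n₀, (((Finset.range (2 ^ n) ×ˢ Finset.range (2 ^ n)).filter fun Na : ℕ × ℕ => (∃ p q : ℕ, p.Prime ∧ q.Prime ∧ p ≠ q ∧ Na.1 = p * q) ∧ 2 ^ (n - 1) < Na.1 ∧ Na.2 < Na.1 ∧ Nat.Co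

/-! D-0027 §2.1 — DECIDING THEOREM (planner-authored via `route open/edit --closes-file`; by planner-rrefute-QuantumAdvantage-ShorLocallyDa-226eb033-g4-0 2026-08-15T16:19:02Z):
its hypotheses are this route's items and its conclusion the sub-problem Statement (glue_lint), and it elaborates with this file. -/

@[closes "route-QuantumAdvantage-ShorLocallyDark"] theorem closes (h0 : ClosureThesis) (_h2 : MixedMarginalsDarkR) (_h4 : WorkDigitsEquidistributed) (_s3 : OrderSparseMultiplesRare) (_s5 : ControlMarginalFormula) (_s6 : SparseMultiplesLinear) (_s7 : SparseMultipleExists) (_hA : Assembly) : ¬ _root_.QuantumAdvantage :=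
  fun ⟨_, hL, hnL⟩ => hnL (h0 hL)

end Summit.QuantumAdvantage.QuantumAdvantage.Theses.ShorLocallyDark
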